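import Summits.AtomisticToContinuum.HydrodynamicLimit.Theorems.InfluenceLocality.Negative.PhaseScript
import Summits.AtomisticToContinuum.HydrodynamicLimit.Theorems.AntiMazurCoboundariesCellForecastPressureDecayKinematicAssemblyNoCollision
import Literature.Analysis.FluidPDE.HardSphereCollisionRecord
import Literature.Analysis.FluidPDE.HardSphereDynamicsProofs
import Literature.Analysis.FluidPDE.HardSphereFreeStretch
import HarnessLib

/-!
# Phase tracking along a valid phase script, preliminaries (stub `stub_phaseTracking`, line
# `ignition-cascade-refutation`, crux `InfluenceLocality`, stmt-AtomisticToContinuum-13916)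

Bookkeeping for the abstract robust-tracking theorem (Negative/PhaseTracking.lean) of a hard-sphere trajectory of `𝕋³`
along a track-valid phase script (`PhaseScript.TrackValid`, Negative/PhaseScript.lean):

* `phaseIdx ε γ i t` — the ghost phase index: the number of collision times of `i` in `(0, t]`
  (`phaseIdx_zero`, `phaseIdx_eq_of_forall_not_participates`, `phaseIdx_mono`, `phaseIdx_succ`);
* `trackSet S ε γ` — the set of times at which the TRACKING INVARIANT holds: every particle is in the phase of its
  ghost index, the index is `≤ K i`, the time is strictly before the current deadline, and no designed partner of a
  future event is ahead of the phase the design expects (which makes simultaneous (particle, phase) pairs schedule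
  consistent, as `sep` requires, and drives the deadline step);
* `zero_mem_trackSet`; `exists_Ico_subset_trackSet` (right extension by free flight, `inv`); `exists_free_window`
  (a collision-free window `(y, t')` before any time, with constant indices and `t'` at most the current deadlines);
  `le_deadline_of_participates` (a collision raising the index from `m` happens no later than `deadline i m`);
* `lt_deadline_of_window` — a deadline is never reached in a pre-event phase: the designed partner is neither ahead
  (invariant) nor behind (strict `order`) of schedule, both partners entered their phases by the entry bound and do
  not collide afterwards, so `prog` makes the freely flying pair overlap before the deadline, contradicting the hard
  core.

References: Gallagher–Saint-Raymond–Texier 2013 §4.1 (hard-sphere trajectories); Cercignani–Illner–Pulvirenti 1994 §4.2.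
-/

namespace Summit.AtomisticToContinuum.HydrodynamicLimit.Theorems.InfluenceLocality.Negative

open MeasureTheory Set Filter Topology
open scoped InnerProductSpace
open Literature.Analysis.FluidPDE Literature.MathematicalPhysics.KineticTheory
open Literature.Analysis.FunctionSpaces
open Summit.AtomisticToContinuum.HydrodynamicLimit.Theorems.EnskogCompensator
  (apply_eq_freeFlight_of_forall_not_participates vel_eq_of_forall_not_participates)

noncomputable section

variable {n : ℕ} {ε T : ℝ} {γ : ℝ → Config n (Fin 3) T3}

/-! ## The ghost phase index: number of collisions of a particle in `(0, t]` -/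

/-- The ghost phase index of particle `i` at time `t`: the number of its collision times in `(0, t]`. -/
def phaseIdx (ε : ℝ) (γ : ℝ → Config n (Fin 3) T3) (i : Fin n) (t : ℝ) : ℕ :=
  (collisionTimesOf (Torus.geometry (Fin 3)) ε γ i ∩ Ioc 0 t).ncard

/-- The collision times of a particle in a bounded window `(a, t]` are finitely many. -/
theorem finite_collisionTimesOf_inter_Ioc
    (hγ : IsHardSphereTrajectory (Torus.geometry (Fin 3)) ε n γ) (i : Fin n) (a t : ℝ) :
    (collisionTimesOf (Torus.geometry (Fin 3)) ε γ i ∩ Ioc a t).Finite :=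
  (hγ.locFinite a t).subset (inter_subset_inter (collisionTimesOf_subset γ i) Ioc_subset_Icc_self)

/-- At time `0` the ghost index is `0`. -/
theorem phaseIdx_zero (i : Fin n) : phaseIdx ε γ i 0 = 0 := by
  simp [phaseIdx]

/-- Without participation on `(y, t]` the ghost index does not change. -/
theorem phaseIdx_eq_of_forall_not_participates {i : Fin n} {y t : ℝ} (hyt : y ≤ t)
    (h : ∀ s ∈ Ioc y t, ¬ Participates (Torus.geometry (Fin 3)) ε (γ s) i) :
    phaseIdx ε γ i t = phaseIdx ε γ i y := by
  unfold phaseIdx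
  congr 1
  ext s
  simp only [mem_inter_iff, mem_collisionTimesOf, mem_Ioc]
  constructor
  · rintro ⟨hp, hs0, hst⟩
    refine ⟨hp, hs0, ?_⟩
    by_contra hsy
    exact h s ⟨not_le.1 hsy, hst⟩ hp
  · rintro ⟨hp, hs0, hsy⟩
    exact ⟨hp, hs0, hsy.trans hyt⟩

/-- The ghost index is monotone in time. -/
theorem phaseIdx_mono (hγ : IsHardSphereTrajectory (Torus.geometry (Fin 3)) ε n γ) (i : Fin n)
    {y t : ℝ} (hyt : y ≤ t) : phaseIdx ε γ i y ≤ phaseIdx ε γ i t :=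
  Set.ncard_le_ncard (inter_subset_inter_right _ (Ioc_subset_Ioc_right hyt))
    (finite_collisionTimesOf_inter_Ioc hγ i 0 t)

/-- A participation at `t` after a participation-free `(y, t)` raises the ghost index by one. -/
theorem phaseIdx_succ (hγ : IsHardSphereTrajectory (Torus.geometry (Fin 3)) ε n γ) {i : Fin n}
    {y t : ℝ} (hy : 0 ≤ y) (hyt : y < t)
    (hfree : ∀ s ∈ Ioo y t, ¬ Participates (Torus.geometry (Fin 3)) ε (γ s) i)
    (hpart : Participates (Torus.geometry (Fin 3)) ε (γ t) i) :
    phaseIdx ε γ i t = phaseIdx ε γ i y + 1 := by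
  unfold phaseIdx
  have hset : collisionTimesOf (Torus.geometry (Fin 3)) ε γ i ∩ Ioc 0 t =
      insert t (collisionTimesOf (Torus.geometry (Fin 3)) ε γ i ∩ Ioc 0 y) := by
    ext s
    simp only [mem_insert_iff, mem_inter_iff, mem_collisionTimesOf, mem_Ioc]
    constructor
    · rintro ⟨hp, hs0, hst⟩
      rcases hst.eq_or_lt with rfl | hlt
      · exact Or.inl rfl
      · refine Or.inr ⟨hp, hs0, ?_⟩
        by_contra hsy
        exact hfree s ⟨not_le.1 hsy, hlt⟩ hp
    · rintro (rfl | ⟨hp, hs0, hsy⟩)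
      · exact ⟨hpart, hy.trans_lt hyt, le_rfl⟩
      · exact ⟨hp, hs0, hsy.trans hyt.le⟩
  rw [hset, Set.ncard_insert_of_notMem (fun h => (not_le.2 hyt) h.2.2)
    (finite_collisionTimesOf_inter_Ioc hγ i 0 y)]

/-- If the ghost index at `t` is nonzero, the particle has a collision time in `(0, t]`. -/
theorem exists_participates_of_phaseIdx_ne_zero {i : Fin n} {t : ℝ} (h : phaseIdx ε γ i t ≠ 0) :
    ∃ s ∈ Ioc 0 t, Participates (Torus.geometry (Fin 3)) ε (γ s) i := by
  obtain ⟨s, hs⟩ := Set.nonempty_of_ncard_ne_zero h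
  exact ⟨s, hs.2, hs.1⟩

/-! ## The tracking invariant -/

/-- The tracking set of a phase script along a trajectory: the times `t` at which every particle is in the phase
given by its ghost index, that index is at most `K i`, the time is strictly before the deadline of that phase, and no
designed partner of a future event of a particle is ahead of the phase the design expects. -/
def trackSet (S : PhaseScript n) (ε : ℝ) (γ : ℝ → Config n (Fin 3) T3) : Set ℝ :=
  {t | (∀ i, (t, (γ t i).1, (γ t i).2) ∈ S.phase i (phaseIdx ε γ i t)) ∧
    (∀ i, phaseIdx ε γ i t ≤ S.K i) ∧
    (∀ i, t < S.deadline i (phaseIdx ε γ i t)) ∧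
    (∀ i m, phaseIdx ε γ i t ≤ m → m < S.K i → phaseIdx ε γ (S.partner i m) t ≤ S.pphase i m)}

variable {S : PhaseScript n}

/-- Membership in the tracking set. -/
theorem mem_trackSet {t : ℝ} : t ∈ trackSet S ε γ ↔
    (∀ i, (t, (γ t i).1, (γ t i).2) ∈ S.phase i (phaseIdx ε γ i t)) ∧
    (∀ i, phaseIdx ε γ i t ≤ S.K i) ∧
    (∀ i, t < S.deadline i (phaseIdx ε γ i t)) ∧
    (∀ i m, phaseIdx ε γ i t ≤ m → m < S.K i → phaseIdx ε γ (S.partner i m) t ≤ S.pphase i m) :=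
  Iff.rfl

/-- The invariant at time `0`. -/
theorem zero_mem_trackSet (hS : S.TrackValid ε T) (h0 : ∀ i, ((0 : ℝ), (γ 0 i).1, (γ 0 i).2) ∈ S.phase i 0) :
    (0 : ℝ) ∈ trackSet S ε γ := by
  refine ⟨fun i => ?_, fun i => ?_, fun i => ?_, fun i m _ _ => ?_⟩
  · rw [phaseIdx_zero]; exact h0 i
  · rw [phaseIdx_zero]; exact Nat.zero_le _
  · rw [phaseIdx_zero]; exact hS.deadlinePos i
  · rw [phaseIdx_zero]; exact Nat.zero_le _

/-- **Right extension.** If the invariant holds at `t₀`, it holds on a right neighbourhood `[t₀, t₀ + δ)`: free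
flight up to the next collision (`inv`), indices unchanged, deadlines still ahead. -/
theorem exists_Ico_subset_trackSet (hγ : IsHardSphereTrajectory (Torus.geometry (Fin 3)) ε n γ)
    (hS : S.TrackValid ε T) {t₀ : ℝ} (h : t₀ ∈ trackSet S ε γ) :
    ∃ δ > 0, ∀ t ∈ Ico t₀ (t₀ + δ), t ∈ trackSet S ε γ := by
  classical
  obtain ⟨hmem, hK, hdl, hexp⟩ := h
  obtain ⟨u, hu, hfree⟩ := hγ.exists_Ioo_right_free t₀
  -- `δ`: distance to the next collision-free bound and to the current deadlines
  set F : Finset ℝ := insert (u - t₀) (Finset.univ.image fun i => S.deadline i (phaseIdx ε γ i t₀) - t₀) with hF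
  have hFne : F.Nonempty := ⟨u - t₀, Finset.mem_insert_self _ _⟩
  refine ⟨F.min' hFne, ?_, fun t ht => ?_⟩
  · rw [gt_iff_lt, Finset.lt_min'_iff]
    intro y hy
    rcases Finset.mem_insert.1 hy with rfl | hy
    · linarith
    · obtain ⟨i, -, rfl⟩ := Finset.mem_image.1 hy
      linarith [hdl i]
  · have htu : t < u := by
      have := Finset.min'_le F (u - t₀) (Finset.mem_insert_self _ _)
      linarith [ht.2]
    have htd : ∀ i, t < S.deadline i (phaseIdx ε γ i t₀) := fun i => by
      have := Finset.min'_le F (S.deadline i (phaseIdx ε γ i t₀) - t₀)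
        (Finset.mem_insert_of_mem (Finset.mem_image.2 ⟨i, Finset.mem_univ _, rfl⟩))
      linarith [ht.2]
    have hfree' : ∀ τ ∈ Ioc t₀ t, τ ∉ collisionTimes (Torus.geometry (Fin 3)) ε γ := fun τ hτ =>
      hfree τ ⟨hτ.1, hτ.2.trans_lt htu⟩
    have hidx : ∀ i, phaseIdx ε γ i t = phaseIdx ε γ i t₀ := fun i =>
      phaseIdx_eq_of_forall_not_participates ht.1 fun s hs hp => hfree' s hs (collisionTimesOf_subset γ i hp)
    have hflight : γ t = freeFlight (Torus.geometry (Fin 3)) (t - t₀) (γ t₀) := hγ.free t₀ t ht.1 hfree'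
    refine ⟨fun i => ?_, fun i => ?_, fun i => ?_, fun i m hm hmK => ?_⟩
    · rw [hidx i, hflight, freeFlight_apply, Torus.geometry_translate]
      have := hS.inv i _ t₀ (γ t₀ i).1 (γ t₀ i).2 (t - t₀) (hmem i) (sub_nonneg.2 ht.1)
      rwa [add_sub_cancel] at this
    · rw [hidx i]; exact hK i
    · rw [hidx i]; exact htd i
    · rw [hidx] at hm ⊢; exact hexp i m hm hmK


/-! ## Left closure: the invariant passes to the next critical time -/

/-- Contact is symmetric on the torus (the minimal-image distance is symmetric). -/
theorem torus_contactSet_comm {z : Config n (Fin 3) T3} {i j : Fin n} :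
    z ∈ contactSet (Torus.geometry (Fin 3)) n ε i j ↔ z ∈ contactSet (Torus.geometry (Fin 3)) n ε j i := by
  rw [mem_contactSet, mem_contactSet, Torus.norm_geometry_sepVec, Torus.norm_geometry_sepVec,
    Torus.euclidDist_comm]

/-- **Free window before a time.** If the invariant holds on `[0, t')` (`0 < t'`), there is `y ∈ [0, t')` with
`(y, t')` collision-free, the invariant at `y`, constant ghost indices on `[y, t')`, and `t'` at most every current
deadline. -/
theorem exists_free_window (hγ : IsHardSphereTrajectory (Torus.geometry (Fin 3)) ε n γ) {t' : ℝ} (h0t : 0 < t')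
    (h : ∀ t ∈ Ico 0 t', t ∈ trackSet S ε γ) :
    ∃ y, 0 ≤ y ∧ y < t' ∧ (∀ s ∈ Ioo y t', s ∉ collisionTimes (Torus.geometry (Fin 3)) ε γ) ∧
      y ∈ trackSet S ε γ ∧ (∀ i, ∀ t ∈ Ico y t', phaseIdx ε γ i t = phaseIdx ε γ i y) ∧
      ∀ i, t' ≤ S.deadline i (phaseIdx ε γ i y) := by
  obtain ⟨s₀, hs₀, hfree⟩ := hγ.exists_Ioo_left_free t'
  obtain ⟨y, hy0, hyt, hsy⟩ : ∃ y, 0 ≤ y ∧ y < t' ∧ s₀ < y :=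
    ⟨max (t' / 2) ((s₀ + t') / 2), le_trans (by linarith) (le_max_left _ _), max_lt (by linarith) (by linarith),
      lt_of_lt_of_le (by linarith) (le_max_right _ _)⟩
  have hfree' : ∀ s ∈ Ioo y t', s ∉ collisionTimes (Torus.geometry (Fin 3)) ε γ := fun s hs =>
    hfree s ⟨hsy.trans hs.1, hs.2⟩
  have hidx : ∀ i, ∀ t ∈ Ico y t', phaseIdx ε γ i t = phaseIdx ε γ i y := fun i t ht =>
    phaseIdx_eq_of_forall_not_participates ht.1 fun s hs hp =>
      hfree' s ⟨hs.1, hs.2.trans_lt ht.2⟩ (collisionTimesOf_subset γ i hp)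
  refine ⟨y, hy0, hyt, hfree', h y ⟨hy0, hyt⟩, hidx, fun i => ?_⟩
  by_contra hlt
  push Not at hlt
  have ht : max y (S.deadline i (phaseIdx ε γ i y)) ∈ Ico y t' := ⟨le_max_left _ _, max_lt hyt hlt⟩
  have h1 := (h _ ⟨hy0.trans ht.1, ht.2⟩).2.2.1 i
  rw [hidx i _ ht] at h1
  exact (not_lt.2 (le_max_right y (S.deadline i (phaseIdx ε γ i y)))) h1

/-- A collision of particle `i` at a time `τ ∈ (0, d)` of a tracked stretch `[0, d)` raises its ghost index
from `m` to `m + 1` no later than `deadline i m`. -/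
theorem le_deadline_of_participates (hγ : IsHardSphereTrajectory (Torus.geometry (Fin 3)) ε n γ) {d τ : ℝ}
    (h : ∀ t ∈ Ico 0 d, t ∈ trackSet S ε γ) (hτ0 : 0 < τ) (hτd : τ < d) {i : Fin n}
    (hp : Participates (Torus.geometry (Fin 3)) ε (γ τ) i) :
    1 ≤ phaseIdx ε γ i τ ∧ τ ≤ S.deadline i (phaseIdx ε γ i τ - 1) := by
  obtain ⟨y, hy0, hyτ, hfree, -, -, hdl⟩ :=
    exists_free_window (S := S) hγ hτ0 fun t ht => h t ⟨ht.1, ht.2.trans hτd⟩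
  have hsucc : phaseIdx ε γ i τ = phaseIdx ε γ i y + 1 :=
    phaseIdx_succ hγ hy0 hyτ (fun s hs hp' => hfree s hs (collisionTimesOf_subset γ i hp')) hp
  refine ⟨by omega, ?_⟩
  rw [hsucc, Nat.add_sub_cancel]
  exact hdl i

/-- **A deadline is never reached in a pre-event phase** (step (d)). If the invariant holds on `[0, t')`,
`0 < t' ≤ T`, and `t'` is at most every current deadline (ghost indices being constant on a window `[y, t')`), then
every current deadline is STRICTLY after `t'`. Otherwise `t'` is the deadline of the current phase `k < K i` of some
`i`; its designed partner `j` is not ahead of the expected phase `l` (invariant) nor behind it (STRICT `order`: it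
would have had to leave its current phase strictly before `t'`), so it is in phase `l`; both entered their phases
(at their last collisions before `t'`, or at time `0`) no later than the entry bound of `(i, k)`
(`le_deadline_of_participates`, `order`), they do not collide afterwards before `t'`, so from the later entry time
`prog` makes the freely flying pair (`apply_eq_freeFlight_of_forall_not_participates`) overlap before `t'`,
contradicting the hard core. -/
theorem lt_deadline_of_window (hγ : IsHardSphereTrajectory (Torus.geometry (Fin 3)) ε n γ) (hS : S.TrackValid ε T)
    {t' y : ℝ} (h0t : 0 < t') (ht'T : t' ≤ T) (h : ∀ t ∈ Ico 0 t', t ∈ trackSet S ε γ) (hy0 : 0 ≤ y)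
    (hyt : y < t') (hidx : ∀ i, ∀ t ∈ Ico y t', phaseIdx ε γ i t = phaseIdx ε γ i y)
    (hdl : ∀ i, t' ≤ S.deadline i (phaseIdx ε γ i y)) (i : Fin n) :
    t' < S.deadline i (phaseIdx ε γ i y) := by
  have hGc : ∀ x, Continuous ((Torus.geometry (Fin 3)).translate x) := Torus.continuous_geometry_translate
  by_contra hnot
  have hdeq : S.deadline i (phaseIdx ε γ i y) = t' := le_antisymm (not_lt.1 hnot) (hdl i)
  obtain ⟨hmem, hK, -, hexp⟩ := h y ⟨hy0, hyt⟩
  have hkK : phaseIdx ε γ i y < S.K i := by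
    refine (hK i).lt_of_ne fun heq => ?_
    have := hS.lastDeadline i
    rw [← heq, hdeq] at this
    linarith
  generalize hk : phaseIdx ε γ i y = k at hdeq hkK
  have hjl : phaseIdx ε γ (S.partner i k) y ≤ S.pphase i k := hexp i k hk.le hkK
  rcases hjl.lt_or_eq with hlt | heq
  · -- the partner is behind schedule: excluded by the strict order
    have h1 := hS.order i k hkK (by omega)
    have h2 := hS.deadline_mono (S.partner i k) (Nat.le_sub_one_of_lt hlt)
    have h3 := hdl (S.partner i k)
    rw [hdeq] at h1
    linarith
  · -- the partner is in the expected phase: entry times, `prog`, hard core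
    have hji : S.partner i k ≠ i := (hS.partnerMutual i k hkK).1
    have hfinI := hγ.finite_collisionTimesOf_inter_Ioo i 0 t'
    have hfinJ := hγ.finite_collisionTimesOf_inter_Ioo (S.partner i k) 0 t'
    obtain ⟨tI, htI⟩ : ∃ tI, tI = flightStart (Torus.geometry (Fin 3)) ε γ 0 i t' := ⟨_, rfl⟩
    obtain ⟨tJ, htJ⟩ : ∃ tJ, tJ = flightStart (Torus.geometry (Fin 3)) ε γ 0 (S.partner i k) t' := ⟨_, rfl⟩
    have htI0 : 0 ≤ tI := by rw [htI]; exact le_flightStart hfinI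
    have htJ0 : 0 ≤ tJ := by rw [htJ]; exact le_flightStart hfinJ
    have htIt : tI < t' := by rw [htI]; exact flightStart_lt hfinI h0t
    have htJt : tJ < t' := by rw [htJ]; exact flightStart_lt hfinJ h0t
    have hnpI : ∀ u ∈ Ioo tI t', ¬ Participates (Torus.geometry (Fin 3)) ε (γ u) i := fun u hu =>
      hγ.not_participates_of_mem_Ioo_flightStart (a := 0) (by rw [← htI]; exact hu)
    have hnpJ : ∀ u ∈ Ioo tJ t', ¬ Participates (Torus.geometry (Fin 3)) ε (γ u) (S.partner i k) := fun u hu =>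
      hγ.not_participates_of_mem_Ioo_flightStart (a := 0) (by rw [← htJ]; exact hu)
    -- the ghost indices on `[tI, t')` and `[tJ, t')`
    have hidxI : ∀ u ∈ Ico tI t', phaseIdx ε γ i u = k := fun u hu => by
      have h1 : phaseIdx ε γ i (max y u) = phaseIdx ε γ i u :=
        phaseIdx_eq_of_forall_not_participates (le_max_right _ _) fun s hs =>
          hnpI s ⟨hu.1.trans_lt hs.1, hs.2.trans_lt (max_lt hyt hu.2)⟩
      rw [← h1, hidx i _ ⟨le_max_left _ _, max_lt hyt hu.2⟩, hk]
    have hidxJ : ∀ u ∈ Ico tJ t', phaseIdx ε γ (S.partner i k) u = S.pphase i k := fun u hu => by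
      have h1 : phaseIdx ε γ (S.partner i k) (max y u) = phaseIdx ε γ (S.partner i k) u :=
        phaseIdx_eq_of_forall_not_participates (le_max_right _ _) fun s hs =>
          hnpJ s ⟨hu.1.trans_lt hs.1, hs.2.trans_lt (max_lt hyt hu.2)⟩
      rw [← h1, hidx _ _ ⟨le_max_left _ _, max_lt hyt hu.2⟩, heq]
    -- both entry times are at most the entry bound of `(i, k)`
    have htIE : tI ≤ S.entryBound i k := by
      rcases mem_insert_iff.1 (hγ.flightStart_mem 0 i t') with hI | ⟨hpI, hI0, -⟩
      · rw [htI, hI]; exact hS.entryBound_nonneg i k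
      · rw [← htI] at hpI hI0
        obtain ⟨h1, h2⟩ := le_deadline_of_participates hγ h hI0 htIt hpI
        rw [hidxI tI ⟨le_rfl, htIt⟩] at h1 h2
        exact PhaseScript.TrackValid.le_entryBound_left h1 h2
    have htJE : tJ ≤ S.entryBound i k := by
      rcases mem_insert_iff.1 (hγ.flightStart_mem 0 (S.partner i k) t') with hJ | ⟨hpJ, hJ0, -⟩
      · rw [htJ, hJ]; exact hS.entryBound_nonneg i k
      · rw [← htJ] at hpJ hJ0
        obtain ⟨h1, h2⟩ := le_deadline_of_participates hγ h hJ0 htJt hpJ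
        rw [hidxJ tJ ⟨le_rfl, htJt⟩] at h1 h2
        exact PhaseScript.TrackValid.le_entryBound_right h1 h2
    -- from the later entry time both fly freely until `t'`
    obtain ⟨t₁, ht₁⟩ : ∃ t₁, t₁ = max tI tJ := ⟨_, rfl⟩
    have htI₁ : tI ≤ t₁ := by rw [ht₁]; exact le_max_left _ _
    have htJ₁ : tJ ≤ t₁ := by rw [ht₁]; exact le_max_right _ _
    have ht₁0 : 0 ≤ t₁ := htI0.trans htI₁
    have ht₁t : t₁ < t' := by rw [ht₁]; exact max_lt htIt htJt
    have ht₁E : t₁ ≤ S.entryBound i k := by rw [ht₁]; exact max_le htIE htJE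
    obtain ⟨hmem₁, -, -, -⟩ := h t₁ ⟨ht₁0, ht₁t⟩
    have hmi : (t₁, (γ t₁ i).1, (γ t₁ i).2) ∈ S.phase i k := by
      have := hmem₁ i
      rwa [hidxI t₁ ⟨htI₁, ht₁t⟩] at this
    have hmj : (t₁, (γ t₁ (S.partner i k)).1, (γ t₁ (S.partner i k)).2) ∈
        S.phase (S.partner i k) (S.pphase i k) := by
      have := hmem₁ (S.partner i k)
      rwa [hidxJ t₁ ⟨htJ₁, ht₁t⟩] at this
    obtain ⟨s, hs0, hsd, hdist⟩ := hS.prog i k t₁ _ _ _ _ hkK hmi hmj ht₁0 ht₁E (by rw [hdeq]; exact ht'T)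
    rw [hdeq] at hsd
    have hfi := apply_eq_freeFlight_of_forall_not_participates hγ hGc (le_add_of_nonneg_right hs0)
      (fun u hu => hnpI u ⟨htI₁.trans_lt hu.1, hu.2.trans_lt hsd⟩)
    have hfj := apply_eq_freeFlight_of_forall_not_participates hγ hGc (le_add_of_nonneg_right hs0)
      (fun u hu => hnpJ u ⟨htJ₁.trans_lt hu.1, hu.2.trans_lt hsd⟩)
    have hcore := (mem_hardSphereDomain.1 (hγ.mem (t₁ + s))) i (S.partner i k) hji.symm
    rw [hfi, hfj] at hcore
    simp only [Torus.geometry_translate, add_sub_cancel_left, Torus.norm_geometry_sepVec] at hcore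
    linarith

end

end Summit.AtomisticToContinuum.HydrodynamicLimit.Theorems.InfluenceLocality.Negative
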